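import Literature.AnabelianGeometry.SemiGraphs.PSCGraphicity
import Literature.AnabelianGeometry.SemiGraphs.ProSigmaFreeFactorDisjoint
import HarnessLib

/-!
# [CombGC] Prop. 1.2 (i)(ii) for a PSC datum: group-theoretic sufficient criteria (any number of vertices)

Mochizuki, *A combinatorial version of the Grothendieck conjecture* [CombGC] §1, Prop. 1.2, p. 8
[cite: MochizukiCombGC2007, Prop 1.2 p.8].  For a datum `G : PSCDatum Π` (`PSCFundamentalGroup.lean`,
abc-iut-L3-t4) with ANY underlying semi-graph, the typed predicates of Prop. 1.2 follow from plain
group-theoretic properties of the representative subgroups — the form in which the genuine MULTI-vertex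
instances (closures of free factors of the discrete fundamental group, `ProSigmaFreeFactor*.lean`) feed
them:

* `verticialEdgeLikeCommensurablyTerminal_of` — Prop. 1.2 (ii) from commensurable terminality of each
  `Π_v`, `Π_e`, `Π_c` (conjugates: `commensurator_smul_eq_smul`);
* `unrVerticialCommensurablyTerminal_of_genus_lt_two`, `unrVerticialOpenInterDeterminesVertex_of_genus_lt_two`
  — the "sturdy" clauses are vacuous as soon as one component has genus `< 2`;
* `verticialOpenInterDeterminesVertex_of` — Prop. 1.2 (i), verticial case, from: for `v ≠ w` some
  infinite closed `B ≤ Π_v` meets EVERY conjugate of `Π_w` trivially;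
* `edgeLikeOpenInterDeterminesEdge_of` — Prop. 1.2 (i), edge-like case, from: the edge groups are
  infinite and distinct edges have everywhere-disjoint conjugates;
* `inf_conj_eq_bot_symm` — symmetry of "everywhere-disjoint conjugates".

PROOF-ONLY; no side is taken on [IUTchIII] Cor. 3.12; these are criteria, the instances live elsewhere.
-/

namespace Literature.AnabelianGeometry.SemiGraphs

namespace PSCDatum

open scoped Pointwise
open SemiGraphOfAnabelioids.IsProSigmaCompletion (commensurator_smul_eq_smul
  not_isOpen_inf_subgroupOf_of_inf_eq_bot)

universe u

variable {P : Type u} [Group P] [TopologicalSpace P]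

/-! ### Helpers -/

/-- A conjugate of a closed subgroup is closed (local copy of `isClosed_conj_smul`).
[cite: MochizukiCombGC2007, Def 1.1(ii) p.6] -/
private theorem isClosed_conj_smul₃ [IsTopologicalGroup P] {A : Subgroup P}
    (hA : IsClosed (A : Set P)) (γ : ConjAct P) : IsClosed ((γ • A : Subgroup P) : Set P) := by
  have h : ((γ • A : Subgroup P) : Set P) = (fun x : P => γ⁻¹ • x) ⁻¹' (A : Set P) := by
    ext x
    rw [SetLike.mem_coe, Subgroup.mem_pointwise_smul_iff_inv_smul_mem]
    rfl
  rw [h]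
  refine hA.preimage ?_
  simp only [ConjAct.smul_def]
  fun_prop

omit [TopologicalSpace P] in
/-- Symmetry of everywhere-disjointness of conjugates: if `X ∩ gYg⁻¹ = 1` for all `g`, then
`Y ∩ gXg⁻¹ = 1` for all `g`. [cite: MochizukiCombGC2007, Prop 1.2(i) p.8] -/
theorem inf_conj_eq_bot_symm {X Y : Subgroup P}
    (h : ∀ g : P, X ⊓ ConjAct.toConjAct g • Y = ⊥) (g : P) :
    Y ⊓ ConjAct.toConjAct g • X = ⊥ := by
  have h1 := congrArg (fun Z : Subgroup P => ConjAct.toConjAct g • Z) (h g⁻¹)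
  simp only [Subgroup.smul_inf, ← mul_smul, ← map_mul, mul_inv_cancel, map_one, one_smul,
    Subgroup.smul_bot] at h1
  rwa [inf_comm] at h1

/-- The representative edge groups are closed (local copy of w5-d183's `isClosed_edgeGp`).
[cite: MochizukiCombGC2007, Def 1.1(ii) p.6] -/
private theorem isClosed_edgeGp₃ (G : PSCDatum P) (e : G.graph.N ⊕ G.graph.C) :
    IsClosed (G.edgeGp e : Set P) := by
  rcases e with e | c
  · exact G.isClosed_nodeGp e
  · exact G.isClosed_cuspGp c

/-! ### Prop. 1.2 (ii) -/

/-- **Prop. 1.2 (ii) from commensurable terminality of the representatives**: if every `Π_v`, `Π_e`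
(node) and `Π_c` (cusp) is commensurably terminal in `Π`, then so is every verticial and edge-like
subgroup (their conjugates). [cite: MochizukiCombGC2007, Prop 1.2(ii) p.8] -/
theorem verticialEdgeLikeCommensurablyTerminal_of (G : PSCDatum P)
    (hv : ∀ v, AbsoluteAnabelian.IsCommensurablyTerminal (G.vertGp v))
    (hn : ∀ e, AbsoluteAnabelian.IsCommensurablyTerminal (G.nodeGp e))
    (hc : ∀ c, AbsoluteAnabelian.IsCommensurablyTerminal (G.cuspGp c)) :
    G.VerticialEdgeLikeCommensurablyTerminal := by
  intro A hA
  rcases hA with ⟨v, γ, rfl⟩ | ⟨e, γ, rfl⟩ | ⟨c, γ, rfl⟩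
  · exact commensurator_smul_eq_smul (hv v) γ
  · exact commensurator_smul_eq_smul (hn e) γ
  · exact commensurator_smul_eq_smul (hc c) γ

/-- The unramified clause of Prop. 1.2 (ii) is vacuous when some component has genus `< 2` (`G` is not
sturdy). [cite: MochizukiCombGC2007, Prop 1.2(ii) p.8] -/
theorem unrVerticialCommensurablyTerminal_of_genus_lt_two [IsTopologicalGroup P] (G : PSCDatum P)
    (v : G.graph.V) (hv : G.genus v < 2) : G.UnrVerticialCommensurablyTerminal :=
  fun hst => absurd (hst v) (not_le.mpr hv)

/-- The unramified clause of Prop. 1.2 (i) is vacuous when some component has genus `< 2`.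
[cite: MochizukiCombGC2007, Prop 1.2(i) p.8] -/
theorem unrVerticialOpenInterDeterminesVertex_of_genus_lt_two [IsTopologicalGroup P]
    (G : PSCDatum P) (v : G.graph.V) (hv : G.genus v < 2) :
    G.UnrVerticialOpenInterDeterminesVertex :=
  fun hst => absurd (hst v) (not_le.mpr hv)

/-! ### Prop. 1.2 (i) -/

/-- **Prop. 1.2 (i), verticial case, from everywhere-disjoint witnesses**: suppose that for all vertices
`v ≠ w` there is an infinite closed subgroup `B ≤ Π_v` with `B ∩ gΠ_wg⁻¹ = 1` for EVERY `g ∈ Π` (at a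
multi-vertex curve: the closure of a cusp or sub-free-factor of `Π_v` not involved in `Π_w`).  Then
`γ₁Π_{v₁}γ₁⁻¹ ∩ γ₂Π_{v₂}γ₂⁻¹` open in `γ₁Π_{v₁}γ₁⁻¹` forces `v₁ = v₂`.
[cite: MochizukiCombGC2007, Prop 1.2(i) p.8] -/
theorem verticialOpenInterDeterminesVertex_of [IsTopologicalGroup P] [CompactSpace P]
    (G : PSCDatum P)
    (hsep : ∀ v w : G.graph.V, v ≠ w → ∃ B : Subgroup P, B ≤ G.vertGp v ∧ IsClosed (B : Set P) ∧
      Infinite B ∧ ∀ g : P, B ⊓ ConjAct.toConjAct g • G.vertGp w = ⊥) :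
    G.VerticialOpenInterDeterminesVertex := by
  intro v₁ v₂ γ₁ γ₂ hopen
  by_contra hne
  obtain ⟨B, hBle, hBc, hBinf, hB⟩ := hsep v₁ v₂ hne
  haveI : Infinite (γ₁ • B : Subgroup P) :=
    Infinite.of_injective _ (Subgroup.equivSMul γ₁ B).injective
  refine not_isOpen_inf_subgroupOf_of_inf_eq_bot (A := γ₁ • G.vertGp v₁) (X := γ₂ • G.vertGp v₂)
    (B := γ₁ • B) (Subgroup.pointwise_smul_le_pointwise_smul_iff.mpr hBle)
    (isClosed_conj_smul₃ hBc γ₁) ?_ hopen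
  have h1 := congrArg (fun Z : Subgroup P => γ₁ • Z) (hB (ConjAct.ofConjAct (γ₁⁻¹ * γ₂)))
  simpa only [Subgroup.smul_inf, ← mul_smul, ConjAct.toConjAct_ofConjAct, mul_inv_cancel_left,
    Subgroup.smul_bot] using h1

/-- **Prop. 1.2 (i), edge-like case, from everywhere-disjoint edge groups**: if the edge groups are
infinite and distinct edges have everywhere-disjoint conjugates (`Π_{e₁} ∩ gΠ_{e₂}g⁻¹ = 1` for all
`g`), then `γ₁Π_{e₁}γ₁⁻¹ ∩ γ₂Π_{e₂}γ₂⁻¹` open in `γ₁Π_{e₁}γ₁⁻¹` forces `e₁ = e₂`.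
[cite: MochizukiCombGC2007, Prop 1.2(i) p.8] -/
theorem edgeLikeOpenInterDeterminesEdge_of [IsTopologicalGroup P] [CompactSpace P] (G : PSCDatum P)
    (hinf : ∀ e, Infinite (G.edgeGp e))
    (hsep : ∀ e₁ e₂ : G.graph.N ⊕ G.graph.C, e₁ ≠ e₂ →
      ∀ g : P, G.edgeGp e₁ ⊓ ConjAct.toConjAct g • G.edgeGp e₂ = ⊥) :
    G.EdgeLikeOpenInterDeterminesEdge := by
  intro e₁ e₂ γ₁ γ₂ hopen
  by_contra hne
  haveI := hinf e₁
  haveI : Infinite (γ₁ • G.edgeGp e₁ : Subgroup P) :=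
    Infinite.of_injective _ (Subgroup.equivSMul γ₁ (G.edgeGp e₁)).injective
  refine not_isOpen_inf_subgroupOf_of_inf_eq_bot (A := γ₁ • G.edgeGp e₁) (X := γ₂ • G.edgeGp e₂)
    (B := γ₁ • G.edgeGp e₁) le_rfl (isClosed_conj_smul₃ (isClosed_edgeGp₃ G e₁) γ₁) ?_ hopen
  have h1 := congrArg (fun Z : Subgroup P => γ₁ • Z)
    (hsep e₁ e₂ hne (ConjAct.ofConjAct (γ₁⁻¹ * γ₂)))
  simpa only [Subgroup.smul_inf, ← mul_smul, ConjAct.toConjAct_ofConjAct, mul_inv_cancel_left,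
    Subgroup.smul_bot] using h1

/-- **Prop. 1.2 (i)** (all three clauses) from the two criteria and a component of genus `< 2`.
[cite: MochizukiCombGC2007, Prop 1.2(i) p.8] -/
theorem openInterDeterminesComponent_of [IsTopologicalGroup P] [CompactSpace P] (G : PSCDatum P)
    (hsepV : ∀ v w : G.graph.V, v ≠ w → ∃ B : Subgroup P, B ≤ G.vertGp v ∧ IsClosed (B : Set P) ∧
      Infinite B ∧ ∀ g : P, B ⊓ ConjAct.toConjAct g • G.vertGp w = ⊥)
    (hinf : ∀ e, Infinite (G.edgeGp e))
    (hsepE : ∀ e₁ e₂ : G.graph.N ⊕ G.graph.C, e₁ ≠ e₂ →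
      ∀ g : P, G.edgeGp e₁ ⊓ ConjAct.toConjAct g • G.edgeGp e₂ = ⊥)
    (v : G.graph.V) (hv : G.genus v < 2) :
    G.VerticialOpenInterDeterminesVertex ∧ G.EdgeLikeOpenInterDeterminesEdge ∧
      G.UnrVerticialOpenInterDeterminesVertex :=
  ⟨G.verticialOpenInterDeterminesVertex_of hsepV, G.edgeLikeOpenInterDeterminesEdge_of hinf hsepE,
    G.unrVerticialOpenInterDeterminesVertex_of_genus_lt_two v hv⟩

/-- **Prop. 1.2 (ii)** (both clauses) from commensurable terminality of the representatives and a
component of genus `< 2`. [cite: MochizukiCombGC2007, Prop 1.2(ii) p.8] -/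
theorem commensurablyTerminal_of [IsTopologicalGroup P] (G : PSCDatum P)
    (hvt : ∀ v, AbsoluteAnabelian.IsCommensurablyTerminal (G.vertGp v))
    (hnt : ∀ e, AbsoluteAnabelian.IsCommensurablyTerminal (G.nodeGp e))
    (hct : ∀ c, AbsoluteAnabelian.IsCommensurablyTerminal (G.cuspGp c))
    (v : G.graph.V) (hv : G.genus v < 2) :
    G.VerticialEdgeLikeCommensurablyTerminal ∧ G.UnrVerticialCommensurablyTerminal :=
  ⟨G.verticialEdgeLikeCommensurablyTerminal_of hvt hnt hct,
    G.unrVerticialCommensurablyTerminal_of_genus_lt_two v hv⟩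

end PSCDatum

end Literature.AnabelianGeometry.SemiGraphs
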